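import Mathlib
import Literature.Computability.AlgebraicComplexity.SchoenhageTau
import Literature.Computability.AlgebraicComplexity.MatrixMultiplicationExponent
import Literature.Computability.AlgebraicComplexity.BorderRankMatMulThreeHalves
import HarnessLib

/-!
# Border rank of small matrix multiplication tensors: the printed values (named facts)

Topic `Literature/Computability/AlgebraicComplexity` (family `MatrixMultiplication`). Requested by
route `MatrixMultiplication/FidelityWitnesses` (cruxes `FidelityGapTwoSix`, `FidelityGapThreeSeventeen`,
support `FidelityGapThreeSixteen`, whose border-rank readings are `R̲(⟨2,2,2⟩) ≥ 7`,
`R̲(⟨3,3,3⟩) ≥ 18`, `R̲(⟨3,3,3⟩) ≥ 17`), and useful to `BorderRankLowerBound`,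
`WindowedCompletionRank`, `ApproximationProfile`. The tree PROVES the classical bounds
`R̲(⟨2,2,2⟩) ≥ 6`, `R̲(⟨3,3,3⟩) ≥ 15`, `R̲(⟨4,4,4⟩) ≥ 28` (`BorderRankMatMulThreeHalves.lean`) and the
Koszul-flattening inequality behind Landsberg–Ottaviani (`KoszulFlatteningBorderRank.lean`); the
sharper PRINTED values below are vendored as named facts (statements only, D-0014), for the tree's
algebraic border rank `algBorderRank` over `ℂ[ε]` (Bläser 2013 Def. 6.1 = BCS (15.19)–(15.20)),
which over `ℂ` is the border rank `R̲` of the sources (secant variety / Euclidean closure: Alder's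
theorem BCS (20.3) with (20.24), in tree as the named fact
`alder_secantVariety_eq_setOf_algBorderRank_le` and the proved
`tensorZariskiClosure_setOf_tensorRank_le_eq_closure`, `AlderStrassen.lean`). The rank (not border
rank) statements of Landsberg 2017 §1.1.14 are in `SmallFormatMatMulRank.lean`.

Format convention: the sources' `M_⟨u,v,w⟩ ∈ ℂ^{uv} ⊗ ℂ^{vw} ⊗ ℂ^{wu}` (product of a `u × v` by a
`v × w` matrix) is the tree's `matMulTensor ℂ u v w : (Fin u × Fin w) → (Fin u × Fin v) →
(Fin v × Fin w) → ℂ` (output slot first); border rank is invariant under the cyclic/transpose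
symmetries of `⟨u,v,w⟩`, so no generality is lost by this placement.

## The printed statements

* J. M. Landsberg, *The border rank of the multiplication of 2 × 2 matrices is seven*, J. Amer.
  Math. Soc. 19 (2006) 447–459 (held `paper:doi-10-1090-s0894-0347-05-00506-0`, p. 447: "In this
  paper we prove the theorem stated in the title. Let `M_Mult ∈ ℂ⁴ ⊗ ℂ⁴ ⊗ ℂ⁴` denote the matrix
  multiplication operator for `2 × 2` matrices. Strassen showed that `M_Mult ∉ σ₅(ℙ³ × ℙ³ × ℙ³)`.");
  first hand-checkable algebraic proof: Conner–Harper–Landsberg 2023, §1 ("We give the first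
  hand-checkable algebraic proof that `R̲(M⟨2⟩) = 7`"); also Hauenstein–Ikenmeyer–Landsberg 2013.
* A. Conner, A. Harper, J. M. Landsberg, *New lower bounds for matrix multiplication and `det₃`*,
  Forum Math. Pi 11 (2023) e17 = arXiv:1911.07981 (held, chunks 3–4): "**Theorem 1.1.**
  `R̲(M⟨3⟩) ≥ 17`. The previous lower bounds were `16` [LM 2017] in 2018, `15` [LO 2015] in 2015, and
  `14` [Strassen] in 1983." — "**Theorem 1.3.** `R̲(M_⟨223⟩) = 10`." — "**Theorem 1.4.**
  `R̲(M_⟨233⟩) = 14`. […]".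
* J. M. Landsberg, *Geometry and Complexity Theory* (CUP 2017), §1.1.14, p. 20: "For `n = 3`, we
  only know `16 ≤ R̲(M⟨3⟩) ≤ 20`" (the upper bound is Smirnov 2013's border-rank-20 scheme).
* J. M. Landsberg, M. Michałek, *A `2n² − log₂(n) − 1` lower bound for the border rank of matrix
  multiplication*, IMRN 2018 = arXiv:1608.07486 (held, chunk 3): "**Theorem 1.1.** Let `0 < m < n`.
  Then `R̲(M_⟨n,n,w⟩) ≥ 2nw − w + m − ⌊ w·C(n−1+m, m−1) / C(2n−2, n−1) ⌋`. In particular, taking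
  `w = n` and `m = n − ⌈log₂(n)⌉ − 1`, `R̲(M⟨n⟩) ≥ 2n² − ⌈log₂(n)⌉ − 1`."

What is NOT here: `R̲(det₃) = 17` (CHL Thm. 1.2; the upper bound is discharged in tree as
`CGLV2022_borderRank_skewCw2_sq_le` via `T_{skewcw,2}^{⊠2} ≅ det₃`), the rectangular families of
CHL Thm. 1.4–1.5, and any proof.

## References

* [Landsberg2005] J. M. Landsberg, J. Amer. Math. Soc. 19 (2006), no. 2, 447–459,
  doi:10.1090/S0894-0347-05-00506-0 — main theorem (title), p. 447.
* [ConnerHarperLandsberg2023] A. Conner, A. Harper, J. M. Landsberg, Forum Math. Pi 11 (2023) e17,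
  doi:10.1017/fmp.2023.14, arXiv:1911.07981 — Thm. 1.1, 1.3, 1.4, §1.
* [LandsbergGCT2017] J. M. Landsberg, *Geometry and Complexity Theory*, CUP 2017 — §1.1.14 (p. 20).
* [Smirnov2013] A. V. Smirnov, Comput. Math. Math. Phys. 53 (2013) 1781–1795 — `R̲(M⟨3⟩) ≤ 20`,
  cited through LandsbergGCT2017 §1.1.14 and CHL 2023 §1.
* [LandsbergMichalek2018] J. M. Landsberg, M. Michałek, IMRN 2018 (15) 4722–4733, arXiv:1608.07486 —
  Thm. 1.1.
* [HauensteinIkenmeyerLandsberg2013] J. D. Hauenstein, C. Ikenmeyer, J. M. Landsberg, Exp. Math. 22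
  (2013) 372–383 — computer-aided proof of `R̲(M⟨2⟩) = 7`.
-/

noncomputable section

namespace Literature.Computability.AlgebraicComplexity

/-- **Landsberg 2006: `R̲(⟨2,2,2⟩) = 7`** (J. Amer. Math. Soc. 19, main theorem = the title, p. 447:
`M_Mult ∉ σ₆(ℙ³ × ℙ³ × ℙ³)`, with Strassen's algorithm for `≤ 7`; hand-checkable proof in
Conner–Harper–Landsberg 2023, §1). For the tree's `algBorderRank` over `ℂ` (= border rank over `ℂ`,
Alder–Strassen). The lower half `6 ≤ R̲` is PROVED in tree
(`six_le_algBorderRank_matMulTensor_two`); this is the missing unit (BCS Problem 15.1). A named fact,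
not proved here. [cite: Landsberg2005, main theorem (p. 447)] -/
def Landsberg2005_borderRank_matMulTensor_two : Prop :=
  algBorderRank (matMulTensor ℂ 2 2 2) = 7

/-- **Conner–Harper–Landsberg 2023, Theorem 1.1: `R̲(M⟨3⟩) ≥ 17`** ("The previous lower bounds
were `16` in 2018, `15` in 2015, and `14` in 1983"; border apolarity). For `algBorderRank` over `ℂ`;
the tree proves `15 ≤ R̲(⟨3,3,3⟩)` (`fifteen_le_algBorderRank_matMulTensor_three`). A named fact, not
proved here. [cite: ConnerHarperLandsberg2023, Thm. 1.1] -/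
def ConnerHarperLandsberg2023_thm_1_1 : Prop :=
  17 ≤ algBorderRank (matMulTensor ℂ 3 3 3)

/-- **Conner–Harper–Landsberg 2023, Theorem 1.3: `R̲(M_⟨2,2,3⟩) = 10`** ("The upper bound dates
all the way back to Bini et al. in 1980"). `M_⟨2,2,3⟩` = product of a `2 × 2` by a `2 × 3` matrix
= `matMulTensor ℂ 2 2 3`. A named fact, not proved here. [cite: ConnerHarperLandsberg2023, Thm. 1.3] -/
def ConnerHarperLandsberg2023_thm_1_3 : Prop :=
  algBorderRank (matMulTensor ℂ 2 2 3) = 10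

/-- **Conner–Harper–Landsberg 2023, Theorem 1.4 (first item): `R̲(M_⟨2,3,3⟩) = 14`**
(`M_⟨2,3,3⟩` = product of a `2 × 3` by a `3 × 3` matrix = `matMulTensor ℂ 2 3 3`). A named fact,
not proved here. [cite: ConnerHarperLandsberg2023, Thm. 1.4] -/
def ConnerHarperLandsberg2023_thm_1_4_233 : Prop :=
  algBorderRank (matMulTensor ℂ 2 3 3) = 14

/-- **`16 ≤ R̲(⟨3,3,3⟩) ≤ 20` over `ℂ`** (Landsberg 2017, §1.1.14, p. 20, as printed: "For `n = 3`,
we only know `16 ≤ R̲(M⟨3⟩) ≤ 20`"; the upper bound is Smirnov 2013's approximate algorithm with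
`20` multiplications, the lower bound Landsberg–Michałek; since superseded below by `17`
(`ConnerHarperLandsberg2023_thm_1_1`) — vendored for the UPPER bound, which is the best in print).
Border-rank statement only (the rank window `19 ≤ R ≤ 23` of the same sentence is
`LandsbergGCT2017_tensorRank_matMulTensor_three`, `SmallFormatMatMulRank.lean`).
[cite: LandsbergGCT2017, §1.1.14 (p. 20)] -/
def LandsbergGCT2017_borderRank_matMulTensor_three : Prop :=
  16 ≤ algBorderRank (matMulTensor ℂ 3 3 3) ∧ algBorderRank (matMulTensor ℂ 3 3 3) ≤ 20

/-- Reading the two facts together: the printed window for `3 × 3` is `R̲(⟨3,3,3⟩) ∈ [17, 20]`, so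
a fidelity gap at `(n, r) = (3, 17)` (route `FidelityWitnesses`, i.e. `R̲ ≥ 18`) is OPEN in print and
`r = 20` is excluded. [cite: ConnerHarperLandsberg2023, Thm. 1.1] -/
theorem borderRank_matMulTensor_three_window (h₁ : ConnerHarperLandsberg2023_thm_1_1)
    (h₂ : LandsbergGCT2017_borderRank_matMulTensor_three) :
    17 ≤ algBorderRank (matMulTensor ℂ 3 3 3) ∧ algBorderRank (matMulTensor ℂ 3 3 3) ≤ 20 :=
  ⟨h₁, h₂.2⟩

/-- **Landsberg–Michałek 2018, Theorem 1.1** (IMRN; border substitution method + Koszul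
flattenings): "Let `0 < m < n`. Then
`R̲(M_⟨n,n,w⟩) ≥ 2nw − w + m − ⌊ w · C(n−1+m, m−1) / C(2n−2, n−1) ⌋`."
Rendering: `M_⟨n,n,w⟩` = `matMulTensor ℂ n n w` (an `n × n` by an `n × w` matrix), `w ≥ 1` (a
dimension); the bound is written in `ℤ` with the floor as natural-number division (all quantities
are natural numbers, `2nw ≥ w`). A named fact, not proved here. [cite: LandsbergMichalek2018, Thm. 1.1] -/
def LandsbergMichalek2018_thm_1_1 : Prop :=
  ∀ n m w : ℕ, 0 < m → m < n → 1 ≤ w →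
    ((2 * n * w - w + m : ℕ) : ℤ) -
        ((w * Nat.choose (n - 1 + m) (m - 1) / Nat.choose (2 * n - 2) (n - 1) : ℕ) : ℤ) ≤
      (algBorderRank (matMulTensor ℂ n n w) : ℤ)

/-- **Landsberg–Michałek 2018, the headline bound** (Thm. 1.1, "In particular, taking `w = n` and
`m = n − ⌈log₂(n)⌉ − 1`, `R̲(M⟨n⟩) ≥ 2n² − ⌈log₂(n)⌉ − 1`"; the title/abstract statement, for all
`n ≥ 1` — for `n ≤ 3` it is implied by the classical bounds `1, 7 ≥ 6, 15`). Rendering without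
subtraction: `2n² ≤ R̲(⟨n,n,n⟩) + ⌈log₂ n⌉ + 1` with `⌈log₂ n⌉ = Nat.clog 2 n`. A named fact, not
proved here. [cite: LandsbergMichalek2018, Thm. 1.1] -/
def LandsbergMichalek2018_borderRank_matMulTensor : Prop :=
  ∀ n : ℕ, 1 ≤ n → 2 * n ^ 2 ≤ algBorderRank (matMulTensor ℂ n n n) + Nat.clog 2 n + 1

/-- Reading the headline bound at `n = 4`: `R̲(⟨4,4,4⟩) ≥ 32 − 2 − 1 = 29` (the tree proves `28`,
`twentyeight_le_algBorderRank_matMulTensor_four`). [cite: LandsbergMichalek2018, Thm. 1.1] -/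
theorem LandsbergMichalek2018_borderRank_matMulTensor.four
    (h : LandsbergMichalek2018_borderRank_matMulTensor) :
    29 ≤ algBorderRank (matMulTensor ℂ 4 4 4) := by
  have h4 := h 4 (by norm_num)
  have hc : Nat.clog 2 4 = 2 := by decide
  rw [hc] at h4
  omega

/-! ## The "in particular" of Landsberg–Michałek 2018, Thm. 1.1 (proved glue)

The headline bound `R̲(M⟨n⟩) ≥ 2n² − ⌈log₂ n⌉ − 1` is the case `w = n`, `m = n − ⌈log₂ n⌉ − 1` of
Theorem 1.1, the floor term vanishing (LM 2018, §3, first paragraph: "taking `m = n − c`, we want `c`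
such that `n·C(2n−1−c, n)/C(2n−2, n−1) < 1`. This ratio is
`(n−1)⋯(n−c) / ((2n−2)(2n−3)⋯(2n−c)) = …` so if `c − 1 ≥ log₂(n)` it is less than one"); for
`n ≤ 3` (where `m ≤ 0`) the bound is the tree's proved `R̲(⟨1,1,1⟩) ≥ 1`, `R̲(⟨2,2,2⟩) ≥ 6`,
`R̲(⟨3,3,3⟩) ≥ 15` (`BorderRankMatMulThreeHalves.lean`). Below, the ratio estimate is proved in the
subtraction-free parametrisation `n = k + 2 + j` (`k = c − 1`), by induction on `k` exactly as the
displayed product suggests (each factor `(n−1−i)/(2n−2−i) ≤ 1/2`). -/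

/-- The binomial estimate behind the "in particular" of LM 2018, Thm. 1.1: with `n = k + 2 + j`,
`n · C(2n−2−k, n−2−k) · 2^k ≤ (n−1−k) · C(2n−2, n−1)`, written without subtractions as
`(k+2+j) · C(k+2+2j, j) · 2^k ≤ (j+1) · C(2k+2+2j, k+1+j)` (equality at `k = 0`; the inductive step
is `C(N+1, j+1)(j+1) = (N+1) C(N, j)` and `2(j+2) ≤ k+4+2j`).
[cite: LandsbergMichalek2018, §3 (first paragraph, proof of the "in particular")] -/
theorem LandsbergMichalek2018_choose_estimate (k j : ℕ) :
    (k + 2 + j) * Nat.choose (k + 2 + 2 * j) j * 2 ^ k ≤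
      (j + 1) * Nat.choose (2 * k + 2 + 2 * j) (k + 1 + j) := by
  induction k generalizing j with
  | zero =>
    -- `C(2j+2, j+1)·(j+1) = C(2j+2, j)·(j+2)`
    have h := Nat.choose_succ_right_eq (2 * j + 2) j
    have e1 : 2 * j + 2 - j = j + 2 := by omega
    rw [e1] at h
    have goal : (0 + 2 + j) * Nat.choose (2 * j + 2) j * 2 ^ 0 ≤
        (j + 1) * Nat.choose (2 * j + 2) (j + 1) := by
      rw [pow_zero, mul_one]
      calc (0 + 2 + j) * Nat.choose (2 * j + 2) j = Nat.choose (2 * j + 2) j * (j + 2) := by ring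
        _ = Nat.choose (2 * j + 2) (j + 1) * (j + 1) := h.symm
        _ = (j + 1) * Nat.choose (2 * j + 2) (j + 1) := by ring
      exact le_rfl
    have e2 : 0 + 2 + 2 * j = 2 * j + 2 := by ring
    have e3 : 2 * 0 + 2 + 2 * j = 2 * j + 2 := by ring
    have e4 : 0 + 1 + j = j + 1 := by ring
    simpa only [e2, e3, e4] using goal
  | succ k ih =>
    have ih' := ih (j + 1)
    have e1 : k + 2 + 2 * (j + 1) = k + 4 + 2 * j := by ring
    have e2 : 2 * k + 2 + 2 * (j + 1) = 2 * k + 4 + 2 * j := by ring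
    have e3 : k + 1 + (j + 1) = k + 2 + j := by ring
    have e4 : k + 2 + (j + 1) = k + 3 + j := by ring
    rw [e1, e2, e3, e4] at ih'
    -- `(N+1)·C(N, j) = C(N+1, j+1)·(j+1)` with `N = k + 3 + 2j`
    have hid : (k + 3 + 2 * j + 1) * Nat.choose (k + 3 + 2 * j) j =
        Nat.choose (k + 3 + 2 * j + 1) (j + 1) * (j + 1) :=
      Nat.add_one_mul_choose_eq (k + 3 + 2 * j) j
    have e5 : k + 3 + 2 * j + 1 = k + 4 + 2 * j := by ring
    rw [e5] at hid
    have goal : (k + 3 + j) * Nat.choose (k + 3 + 2 * j) j * 2 ^ (k + 1) ≤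
        (j + 1) * Nat.choose (2 * k + 4 + 2 * j) (k + 2 + j) := by
      have hpos : 0 < k + 4 + 2 * j := by omega
      refine Nat.le_of_mul_le_mul_right ?_ hpos
      calc (k + 3 + j) * Nat.choose (k + 3 + 2 * j) j * 2 ^ (k + 1) * (k + 4 + 2 * j)
          = 2 * 2 ^ k * (k + 3 + j) * ((k + 4 + 2 * j) * Nat.choose (k + 3 + 2 * j) j) := by
            ring
        _ = 2 * 2 ^ k * (k + 3 + j) * (Nat.choose (k + 4 + 2 * j) (j + 1) * (j + 1)) := by
            rw [hid]
        _ = 2 * (j + 1) * ((k + 3 + j) * Nat.choose (k + 4 + 2 * j) (j + 1) * 2 ^ k) := by ring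
        _ ≤ 2 * (j + 1) * ((j + 1 + 1) * Nat.choose (2 * k + 4 + 2 * j) (k + 2 + j)) :=
            Nat.mul_le_mul_left _ ih'
        _ = (2 * (j + 2)) * ((j + 1) * Nat.choose (2 * k + 4 + 2 * j) (k + 2 + j)) := by ring
        _ ≤ (k + 4 + 2 * j) * ((j + 1) * Nat.choose (2 * k + 4 + 2 * j) (k + 2 + j)) :=
            Nat.mul_le_mul_right _ (by omega)
        _ = (j + 1) * Nat.choose (2 * k + 4 + 2 * j) (k + 2 + j) * (k + 4 + 2 * j) := by ring
    have f1 : k + 1 + 2 + 2 * j = k + 3 + 2 * j := by ring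
    have f2 : 2 * (k + 1) + 2 + 2 * j = 2 * k + 4 + 2 * j := by ring
    have f3 : k + 1 + 1 + j = k + 2 + j := by ring
    have f4 : k + 1 + 2 + j = k + 3 + j := by ring
    simpa only [f1, f2, f3, f4] using goal

/-- `⌈log₂ n⌉ + 2 ≤ n` for `n ≥ 4` (so that `m = n − ⌈log₂ n⌉ − 1 ≥ 1` in LM 2018, Thm. 1.1).
[cite: LandsbergMichalek2018, Thm. 1.1 ("in particular", the choice of m)] -/
theorem clog_two_add_two_le {n : ℕ} (hn : 4 ≤ n) : Nat.clog 2 n + 2 ≤ n := by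
  obtain ⟨m, rfl⟩ : ∃ m, n = m + 4 := ⟨n - 4, by omega⟩
  have hm : m < 2 ^ m := Nat.lt_two_pow_self
  have hle : m + 4 ≤ 2 ^ (m + 2) := by rw [pow_add]; omega
  have := Nat.clog_le_of_le_pow (b := 2) hle
  omega

/-- **The headline bound follows from Theorem 1.1** (LM 2018, §3, first paragraph): for `n ≥ 4`
take `w = n`, `m = n − ⌈log₂ n⌉ − 1 ≥ 1`; then `n · C(n−1+m, m−1) < C(2n−2, n−1)`
(`LandsbergMichalek2018_choose_estimate` with `2^{⌈log₂ n⌉} ≥ n`), the floor term of Thm. 1.1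
vanishes and the bound reads `2n² − n + m = 2n² − ⌈log₂ n⌉ − 1 ≤ R̲(⟨n,n,n⟩)`; for `n ≤ 3` the
statement is the tree's proved `R̲(⟨1,1,1⟩) ≥ 1`, `R̲(⟨2,2,2⟩) ≥ 6`, `R̲(⟨3,3,3⟩) ≥ 15`.
[cite: LandsbergMichalek2018, Thm. 1.1 and §3 (first paragraph)] -/
theorem LandsbergMichalek2018_borderRank_matMulTensor_of_thm_1_1
    (h : LandsbergMichalek2018_thm_1_1) : LandsbergMichalek2018_borderRank_matMulTensor := by
  intro n hn
  rcases Nat.lt_or_ge n 4 with hlt | h4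
  · interval_cases n
    · have h1 := LandsbergOttaviani2015_algBorderRank_matMulTensor ℂ 1 le_rfl
      have hc : Nat.clog 2 1 = 0 := by decide
      rw [hc]
      norm_num at h1 ⊢
      omega
    · have h2 := six_le_algBorderRank_matMulTensor_two ℂ
      have hc : Nat.clog 2 2 = 1 := by decide
      rw [hc]
      norm_num
      omega
    · have h3 := fifteen_le_algBorderRank_matMulTensor_three ℂ
      have hc : Nat.clog 2 3 = 2 := by decide
      rw [hc]
      norm_num
      omega
  · -- `c = ⌈log₂ n⌉`, `n = c + 2 + j`, `m = j + 1`
    have hpow : n ≤ 2 ^ Nat.clog 2 n := Nat.le_pow_clog one_lt_two n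
    have hcn : Nat.clog 2 n + 2 ≤ n := clog_two_add_two_le h4
    set c := Nat.clog 2 n with hc
    obtain ⟨j, hj⟩ : ∃ j, n = c + 2 + j := ⟨n - 2 - c, by omega⟩
    have key := LandsbergMichalek2018_choose_estimate c j
    rw [← hj] at key
    -- the floor term of Thm. 1.1 vanishes
    have hC' : 0 < Nat.choose (2 * c + 2 + 2 * j) (c + 1 + j) := Nat.choose_pos (by omega)
    have hlt : n * Nat.choose (n - 1 + (j + 1)) (j + 1 - 1) <
        Nat.choose (2 * n - 2) (n - 1) := by
      have e1 : n - 1 + (j + 1) = c + 2 + 2 * j := by omega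
      have e2 : j + 1 - 1 = j := by omega
      have e3 : 2 * n - 2 = 2 * c + 2 + 2 * j := by omega
      have e4 : n - 1 = c + 1 + j := by omega
      rw [e1, e2, e3, e4]
      have h1 : n * (n * Nat.choose (c + 2 + 2 * j) j) ≤
          (j + 1) * Nat.choose (2 * c + 2 + 2 * j) (c + 1 + j) :=
        calc n * (n * Nat.choose (c + 2 + 2 * j) j)
            = n * Nat.choose (c + 2 + 2 * j) j * n := by ring
          _ ≤ n * Nat.choose (c + 2 + 2 * j) j * 2 ^ c := Nat.mul_le_mul_left _ hpow
          _ ≤ _ := key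
      have h2 : (j + 1) * Nat.choose (2 * c + 2 + 2 * j) (c + 1 + j) <
          n * Nat.choose (2 * c + 2 + 2 * j) (c + 1 + j) :=
        Nat.mul_lt_mul_of_pos_right (by omega) hC'
      exact Nat.lt_of_mul_lt_mul_left (h1.trans_lt h2)
    have hdiv : n * Nat.choose (n - 1 + (j + 1)) (j + 1 - 1) / Nat.choose (2 * n - 2) (n - 1) = 0 :=
      Nat.div_eq_of_lt hlt
    have hm := h n (j + 1) n (Nat.succ_pos j) (by omega) hn
    rw [hdiv] at hm
    have hm' : 2 * n * n - n + (j + 1) ≤ algBorderRank (matMulTensor ℂ n n n) := by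
      have : ((2 * n * n - n + (j + 1) : ℕ) : ℤ) ≤ (algBorderRank (matMulTensor ℂ n n n) : ℤ) := by
        simpa using hm
      exact_mod_cast this
    have hsq : n ^ 2 = n * n := sq n
    have e2 : 2 * n * n = 2 * (n * n) := by ring
    rw [hsq]
    rw [e2] at hm'
    have hN : n ≤ n * n := Nat.le_mul_self n
    set N := n * n with hNdef
    omega

end Literature.Computability.AlgebraicComplexity

end
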